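import Mathlib
import HarnessLib
import Summits.HubbardSuperconductivity.HubbardSuperconductivity.Theorems.KLProgrammeSalmhoferCutoffSecondDerivEnclosure
import Literature.MathematicalPhysics.QuantumFieldTheory.Balaban1983to89.B12Profile270Bounds

/-!
# Route `KLProgramme` — engine support: a SHARP explicit bound on the second derivative of Salmhofer's cutoff, `|χ₂″| ≤ 176/9 (< 19.6)`

Cell gate-hubbard-kl, seat hubbard-kl-k3c3-p3 (g6).  The far («cutoff-shell») sizes `S_k` of stub (C)'s (C1) door are polynomials in the numerals
`sup|χ₂^{(l)}|`, `l ≤ k`; the tree's `|χ₂″| < 1110` (`…SalmhoferCutoffSecondDerivBound`, `84e²` for `smoothTransition″`) is ≈ 63× the truth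
(`sup|smoothTransition″| ≈ 9.84`, `sup|χ₂″| ≈ 17.5` [float]), which alone sinks the crude certification of the `(k = 2, n = 2)` entry at `P = 7`
(KL STATUS 2026-08-27 l.3010, memo JACKSON-FLAT §5).  This file (part 2 of 2; part 1 = `…SalmhoferCutoffSecondDerivEnclosure`: brackets,
piece lemma, end-point piece, reflection) certifies **`|smoothTransition″| ≤ 11`** on `ℝ` by a monotone interval enclosure of the logistic form
`σ″ = E/(1+E)²·[((E−1)/(E+1))·(u²+w²)² − (2u³ − 2w³)]` (`u = x⁻¹`, `w = (1−x)⁻¹`, `E = e^{u−w}`; `kltd_deriv2_eq`) on 37 sub-intervals of `[1/8, 1/2]`,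
an exponential-decay bound on `(0, 1/8]`, the reflection `x ↦ 1 − x`, and continuity at the end points; the only transcendental input is
`e^{1/8} ∈ [145/128, 4533/4000]` (`Real.quadratic_le_exp_of_nonneg`, `Real.exp_bound'`).  Consequence **`klsh_abs_deriv2_salmhoferCutoff_le`**:
`|χ₂″| ≤ (16/9)·11 = 176/9`.  Pure real analysis; nothing about the model. [folklore; cutoff: cite Salmhofer1999 §4.2.5 (4.71)]
-/

noncomputable section

namespace Summit.HubbardSuperconductivity.HubbardSuperconductivity.Theorems.KLRegimeSplit

set_option linter.dupNamespace false -- summit = problem name (single-conjunct summit), D-0017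

open Real Set Filter Literature.MathematicalPhysics.QuantumLattice
open scoped Topology

/-! ## §1 The 37 pieces covering `[1/8, 1/2]` (generated; every hypothesis a closed rational inequality for `norm_num`) -/

/-- Piece 1: `x ∈ [159/400, 1/2]` (`m = 0`, `L = 1`; `m' = 7`, `U = 2401/1000`). -/
private theorem klsh_p1 {x : ℝ} (h1 : (159 / 400 : ℝ) ≤ x) (h2 : x ≤ 1 / 2) : |deriv (deriv Real.smoothTransition) x| ≤ 11 :=
  klsh_piece' (a := 159 / 400) (b := 1 / 2) (L := 1) (U := 2401 / 1000) 0 7 h1 h2 (by norm_num) (by norm_num) (by norm_num) (by norm_num) (by norm_num)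
    (by norm_num) (by norm_num) (by norm_num) (by norm_num) (by norm_num)

/-- Piece 2: `x ∈ [69/200, 159/400]` (`m = 6`, `L = 2337/1000`; `m' = 11`, `U = 3959/1000`). -/
private theorem klsh_p2 {x : ℝ} (h1 : (69 / 200 : ℝ) ≤ x) (h2 : x ≤ 159 / 400) : |deriv (deriv Real.smoothTransition) x| ≤ 11 :=
  klsh_piece' (a := 69 / 200) (b := 159 / 400) (L := 2337 / 1000) (U := 3959 / 1000) 6 11 h1 h2 (by norm_num) (by norm_num) (by norm_num) (by norm_num) (by norm_num)
    (by norm_num) (by norm_num) (by norm_num) (by norm_num) (by norm_num)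

/-- Piece 3: `x ∈ [63/200, 69/200]` (`m = 10`, `L = 3903/1000`; `m' = 14`, `U = 2881/500`). -/
private theorem klsh_p3 {x : ℝ} (h1 : (63 / 200 : ℝ) ≤ x) (h2 : x ≤ 69 / 200) : |deriv (deriv Real.smoothTransition) x| ≤ 11 :=
  klsh_piece' (a := 63 / 200) (b := 69 / 200) (L := 3903 / 1000) (U := 2881 / 500) 10 14 h1 h2 (by norm_num) (by norm_num) (by norm_num) (by norm_num) (by norm_num)
    (by norm_num) (by norm_num) (by norm_num) (by norm_num) (by norm_num)

/-- Piece 4: `x ∈ [59/200, 63/200]` (`m = 13`, `L = 689/125`; `m' = 16`, `U = 37/5`). -/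
private theorem klsh_p4 {x : ℝ} (h1 : (59 / 200 : ℝ) ≤ x) (h2 : x ≤ 63 / 200) : |deriv (deriv Real.smoothTransition) x| ≤ 11 :=
  klsh_piece' (a := 59 / 200) (b := 63 / 200) (L := 689 / 125) (U := 37 / 5) 13 16 h1 h2 (by norm_num) (by norm_num) (by norm_num) (by norm_num) (by norm_num)
    (by norm_num) (by norm_num) (by norm_num) (by norm_num) (by norm_num)

/-- Piece 5: `x ∈ [9/32, 59/200]` (`m = 15`, `L = 7117/1000`; `m' = 18`, `U = 1188/125`). -/
private theorem klsh_p5 {x : ℝ} (h1 : (9 / 32 : ℝ) ≤ x) (h2 : x ≤ 59 / 200) : |deriv (deriv Real.smoothTransition) x| ≤ 11 :=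
  klsh_piece' (a := 9 / 32) (b := 59 / 200) (L := 7117 / 1000) (U := 1188 / 125) 15 18 h1 h2 (by norm_num) (by norm_num) (by norm_num) (by norm_num) (by norm_num)
    (by norm_num) (by norm_num) (by norm_num) (by norm_num) (by norm_num)

/-- Piece 6: `x ∈ [217/800, 9/32]` (`m = 17`, `L = 8657/1000`; `m' = 19`, `U = 1077/100`). -/
private theorem klsh_p6 {x : ℝ} (h1 : (217 / 800 : ℝ) ≤ x) (h2 : x ≤ 9 / 32) : |deriv (deriv Real.smoothTransition) x| ≤ 11 :=
  klsh_piece' (a := 217 / 800) (b := 9 / 32) (L := 8657 / 1000) (U := 1077 / 100) 17 19 h1 h2 (by norm_num) (by norm_num) (by norm_num) (by norm_num) (by norm_num)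
    (by norm_num) (by norm_num) (by norm_num) (by norm_num) (by norm_num)

/-- Piece 7: `x ∈ [21/80, 217/800]` (`m = 18`, `L = 251/25`; `m' = 20`, `U = 1221/100`). -/
private theorem klsh_p7 {x : ℝ} (h1 : (21 / 80 : ℝ) ≤ x) (h2 : x ≤ 217 / 800) : |deriv (deriv Real.smoothTransition) x| ≤ 11 :=
  klsh_piece' (a := 21 / 80) (b := 217 / 800) (L := 251 / 25) (U := 1221 / 100) 18 20 h1 h2 (by norm_num) (by norm_num) (by norm_num) (by norm_num) (by norm_num)
    (by norm_num) (by norm_num) (by norm_num) (by norm_num) (by norm_num)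

/-- Piece 8: `x ∈ [41/160, 21/80]` (`m = 19`, `L = 1153/100`; `m' = 21`, `U = 346/25`). -/
private theorem klsh_p8 {x : ℝ} (h1 : (41 / 160 : ℝ) ≤ x) (h2 : x ≤ 21 / 80) : |deriv (deriv Real.smoothTransition) x| ≤ 11 :=
  klsh_piece' (a := 41 / 160) (b := 21 / 80) (L := 1153 / 100) (U := 346 / 25) 19 21 h1 h2 (by norm_num) (by norm_num) (by norm_num) (by norm_num) (by norm_num)
    (by norm_num) (by norm_num) (by norm_num) (by norm_num) (by norm_num)

/-- Piece 9: `x ∈ [201/800, 41/160]` (`m = 20`, `L = 1281/100`; `m' = 22`, `U = 392/25`). -/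
private theorem klsh_p9 {x : ℝ} (h1 : (201 / 800 : ℝ) ≤ x) (h2 : x ≤ 41 / 160) : |deriv (deriv Real.smoothTransition) x| ≤ 11 :=
  klsh_piece' (a := 201 / 800) (b := 41 / 160) (L := 1281 / 100) (U := 392 / 25) 20 22 h1 h2 (by norm_num) (by norm_num) (by norm_num) (by norm_num) (by norm_num)
    (by norm_num) (by norm_num) (by norm_num) (by norm_num) (by norm_num)

/-- Piece 10: `x ∈ [197/800, 201/800]` (`m = 21`, `L = 699/50`; `m' = 22`, `U = 392/25`). -/
private theorem klsh_p10 {x : ℝ} (h1 : (197 / 800 : ℝ) ≤ x) (h2 : x ≤ 201 / 800) : |deriv (deriv Real.smoothTransition) x| ≤ 11 :=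
  klsh_piece' (a := 197 / 800) (b := 201 / 800) (L := 699 / 50) (U := 392 / 25) 21 22 h1 h2 (by norm_num) (by norm_num) (by norm_num) (by norm_num) (by norm_num)
    (by norm_num) (by norm_num) (by norm_num) (by norm_num) (by norm_num)

/-- Piece 11: `x ∈ [97/400, 197/800]` (`m = 21`, `L = 1521/100`; `m' = 23`, `U = 1777/100`). -/
private theorem klsh_p11 {x : ℝ} (h1 : (97 / 400 : ℝ) ≤ x) (h2 : x ≤ 197 / 800) : |deriv (deriv Real.smoothTransition) x| ≤ 11 :=
  klsh_piece' (a := 97 / 400) (b := 197 / 800) (L := 1521 / 100) (U := 1777 / 100) 21 23 h1 h2 (by norm_num) (by norm_num) (by norm_num) (by norm_num) (by norm_num)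
    (by norm_num) (by norm_num) (by norm_num) (by norm_num) (by norm_num)

/-- Piece 12: `x ∈ [191/800, 97/400]` (`m = 22`, `L = 1637/100`; `m' = 23`, `U = 1777/100`). -/
private theorem klsh_p12 {x : ℝ} (h1 : (191 / 800 : ℝ) ≤ x) (h2 : x ≤ 97 / 400) : |deriv (deriv Real.smoothTransition) x| ≤ 11 :=
  klsh_piece' (a := 191 / 800) (b := 97 / 400) (L := 1637 / 100) (U := 1777 / 100) 22 23 h1 h2 (by norm_num) (by norm_num) (by norm_num) (by norm_num) (by norm_num)
    (by norm_num) (by norm_num) (by norm_num) (by norm_num) (by norm_num)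

/-- Piece 13: `x ∈ [47/200, 191/800]` (`m = 22`, `L = 437/25`; `m' = 24`, `U = 2013/100`). -/
private theorem klsh_p13 {x : ℝ} (h1 : (47 / 200 : ℝ) ≤ x) (h2 : x ≤ 191 / 800) : |deriv (deriv Real.smoothTransition) x| ≤ 11 :=
  klsh_piece' (a := 47 / 200) (b := 191 / 800) (L := 437 / 25) (U := 2013 / 100) 22 24 h1 h2 (by norm_num) (by norm_num) (by norm_num) (by norm_num) (by norm_num)
    (by norm_num) (by norm_num) (by norm_num) (by norm_num) (by norm_num)

/-- Piece 14: `x ∈ [93/400, 47/200]` (`m = 23`, `L = 1889/100`; `m' = 24`, `U = 2013/100`). -/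
private theorem klsh_p14 {x : ℝ} (h1 : (93 / 400 : ℝ) ≤ x) (h2 : x ≤ 47 / 200) : |deriv (deriv Real.smoothTransition) x| ≤ 11 :=
  klsh_piece' (a := 93 / 400) (b := 47 / 200) (L := 1889 / 100) (U := 2013 / 100) 23 24 h1 h2 (by norm_num) (by norm_num) (by norm_num) (by norm_num) (by norm_num)
    (by norm_num) (by norm_num) (by norm_num) (by norm_num) (by norm_num)

/-- Piece 15: `x ∈ [23/100, 93/400]` (`m = 23`, `L = 1977/100`; `m' = 25`, `U = 1141/50`). -/
private theorem klsh_p15 {x : ℝ} (h1 : (23 / 100 : ℝ) ≤ x) (h2 : x ≤ 93 / 400) : |deriv (deriv Real.smoothTransition) x| ≤ 11 :=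
  klsh_piece' (a := 23 / 100) (b := 93 / 400) (L := 1977 / 100) (U := 1141 / 50) 23 25 h1 h2 (by norm_num) (by norm_num) (by norm_num) (by norm_num) (by norm_num)
    (by norm_num) (by norm_num) (by norm_num) (by norm_num) (by norm_num)

/-- Piece 16: `x ∈ [91/400, 23/100]` (`m = 24`, `L = 523/25`; `m' = 25`, `U = 1141/50`). -/
private theorem klsh_p16 {x : ℝ} (h1 : (91 / 400 : ℝ) ≤ x) (h2 : x ≤ 23 / 100) : |deriv (deriv Real.smoothTransition) x| ≤ 11 :=
  klsh_piece' (a := 91 / 400) (b := 23 / 100) (L := 523 / 25) (U := 1141 / 50) 24 25 h1 h2 (by norm_num) (by norm_num) (by norm_num) (by norm_num) (by norm_num)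
    (by norm_num) (by norm_num) (by norm_num) (by norm_num) (by norm_num)

/-- Piece 17: `x ∈ [9/40, 91/400]` (`m = 24`, `L = 439/20`; `m' = 26`, `U = 1293/50`). -/
private theorem klsh_p17 {x : ℝ} (h1 : (9 / 40 : ℝ) ≤ x) (h2 : x ≤ 91 / 400) : |deriv (deriv Real.smoothTransition) x| ≤ 11 :=
  klsh_piece' (a := 9 / 40) (b := 91 / 400) (L := 439 / 20) (U := 1293 / 50) 24 26 h1 h2 (by norm_num) (by norm_num) (by norm_num) (by norm_num) (by norm_num)
    (by norm_num) (by norm_num) (by norm_num) (by norm_num) (by norm_num)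

/-- Piece 18: `x ∈ [89/400, 9/40]` (`m = 25`, `L = 581/25`; `m' = 26`, `U = 1293/50`). -/
private theorem klsh_p18 {x : ℝ} (h1 : (89 / 400 : ℝ) ≤ x) (h2 : x ≤ 9 / 40) : |deriv (deriv Real.smoothTransition) x| ≤ 11 :=
  klsh_piece' (a := 89 / 400) (b := 9 / 40) (L := 581 / 25) (U := 1293 / 50) 25 26 h1 h2 (by norm_num) (by norm_num) (by norm_num) (by norm_num) (by norm_num)
    (by norm_num) (by norm_num) (by norm_num) (by norm_num) (by norm_num)

/-- Piece 19: `x ∈ [11/50, 89/400]` (`m = 25`, `L = 2447/100`; `m' = 27`, `U = 293/10`). -/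
private theorem klsh_p19 {x : ℝ} (h1 : (11 / 50 : ℝ) ≤ x) (h2 : x ≤ 89 / 400) : |deriv (deriv Real.smoothTransition) x| ≤ 11 :=
  klsh_piece' (a := 11 / 50) (b := 89 / 400) (L := 2447 / 100) (U := 293 / 10) 25 27 h1 h2 (by norm_num) (by norm_num) (by norm_num) (by norm_num) (by norm_num)
    (by norm_num) (by norm_num) (by norm_num) (by norm_num) (by norm_num)

/-- Piece 20: `x ∈ [87/400, 11/50]` (`m = 26`, `L = 2593/100`; `m' = 27`, `U = 293/10`). -/
private theorem klsh_p20 {x : ℝ} (h1 : (87 / 400 : ℝ) ≤ x) (h2 : x ≤ 11 / 50) : |deriv (deriv Real.smoothTransition) x| ≤ 11 :=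
  klsh_piece' (a := 87 / 400) (b := 11 / 50) (L := 2593 / 100) (U := 293 / 10) 26 27 h1 h2 (by norm_num) (by norm_num) (by norm_num) (by norm_num) (by norm_num)
    (by norm_num) (by norm_num) (by norm_num) (by norm_num) (by norm_num)

/-- Piece 21: `x ∈ [43/200, 87/400]` (`m = 26`, `L = 2737/100`; `m' = 28`, `U = 166/5`). -/
private theorem klsh_p21 {x : ℝ} (h1 : (43 / 200 : ℝ) ≤ x) (h2 : x ≤ 87 / 400) : |deriv (deriv Real.smoothTransition) x| ≤ 11 :=
  klsh_piece' (a := 43 / 200) (b := 87 / 400) (L := 2737 / 100) (U := 166 / 5) 26 28 h1 h2 (by norm_num) (by norm_num) (by norm_num) (by norm_num) (by norm_num)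
    (by norm_num) (by norm_num) (by norm_num) (by norm_num) (by norm_num)

/-- Piece 22: `x ∈ [17/80, 43/200]` (`m = 27`, `L = 581/20`; `m' = 28`, `U = 166/5`). -/
private theorem klsh_p22 {x : ℝ} (h1 : (17 / 80 : ℝ) ≤ x) (h2 : x ≤ 43 / 200) : |deriv (deriv Real.smoothTransition) x| ≤ 11 :=
  klsh_piece' (a := 17 / 80) (b := 43 / 200) (L := 581 / 20) (U := 166 / 5) 27 28 h1 h2 (by norm_num) (by norm_num) (by norm_num) (by norm_num) (by norm_num)
    (by norm_num) (by norm_num) (by norm_num) (by norm_num) (by norm_num)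

/-- Piece 23: `x ∈ [21/100, 17/80]` (`m = 27`, `L = 769/25`; `m' = 28`, `U = 166/5`). -/
private theorem klsh_p23 {x : ℝ} (h1 : (21 / 100 : ℝ) ≤ x) (h2 : x ≤ 17 / 80) : |deriv (deriv Real.smoothTransition) x| ≤ 11 :=
  klsh_piece' (a := 21 / 100) (b := 17 / 80) (L := 769 / 25) (U := 166 / 5) 27 28 h1 h2 (by norm_num) (by norm_num) (by norm_num) (by norm_num) (by norm_num)
    (by norm_num) (by norm_num) (by norm_num) (by norm_num) (by norm_num)

/-- Piece 24: `x ∈ [83/400, 21/100]` (`m = 27`, `L = 65/2`; `m' = 29`, `U = 3763/100`). -/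
private theorem klsh_p24 {x : ℝ} (h1 : (83 / 400 : ℝ) ≤ x) (h2 : x ≤ 21 / 100) : |deriv (deriv Real.smoothTransition) x| ≤ 11 :=
  klsh_piece' (a := 83 / 400) (b := 21 / 100) (L := 65 / 2) (U := 3763 / 100) 27 29 h1 h2 (by norm_num) (by norm_num) (by norm_num) (by norm_num) (by norm_num)
    (by norm_num) (by norm_num) (by norm_num) (by norm_num) (by norm_num)

/-- Piece 25: `x ∈ [41/200, 83/400]` (`m = 28`, `L = 868/25`; `m' = 29`, `U = 3763/100`). -/
private theorem klsh_p25 {x : ℝ} (h1 : (41 / 200 : ℝ) ≤ x) (h2 : x ≤ 83 / 400) : |deriv (deriv Real.smoothTransition) x| ≤ 11 :=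
  klsh_piece' (a := 41 / 200) (b := 83 / 400) (L := 868 / 25) (U := 3763 / 100) 28 29 h1 h2 (by norm_num) (by norm_num) (by norm_num) (by norm_num) (by norm_num)
    (by norm_num) (by norm_num) (by norm_num) (by norm_num) (by norm_num)

/-- Piece 26: `x ∈ [81/400, 41/200]` (`m = 28`, `L = 1839/50`; `m' = 30`, `U = 1066/25`). -/
private theorem klsh_p26 {x : ℝ} (h1 : (81 / 400 : ℝ) ≤ x) (h2 : x ≤ 41 / 200) : |deriv (deriv Real.smoothTransition) x| ≤ 11 :=
  klsh_piece' (a := 81 / 400) (b := 41 / 200) (L := 1839 / 50) (U := 1066 / 25) 28 30 h1 h2 (by norm_num) (by norm_num) (by norm_num) (by norm_num) (by norm_num)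
    (by norm_num) (by norm_num) (by norm_num) (by norm_num) (by norm_num)

/-- Piece 27: `x ∈ [1/5, 81/400]` (`m = 29`, `L = 3941/100`; `m' = 30`, `U = 1066/25`). -/
private theorem klsh_p27 {x : ℝ} (h1 : (1 / 5 : ℝ) ≤ x) (h2 : x ≤ 81 / 400) : |deriv (deriv Real.smoothTransition) x| ≤ 11 :=
  klsh_piece' (a := 1 / 5) (b := 81 / 400) (L := 3941 / 100) (U := 1066 / 25) 29 30 h1 h2 (by norm_num) (by norm_num) (by norm_num) (by norm_num) (by norm_num)
    (by norm_num) (by norm_num) (by norm_num) (by norm_num) (by norm_num)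

/-- Piece 28: `x ∈ [157/800, 1/5]` (`m = 30`, `L = 2107/50`; `m' = 31`, `U = 1208/25`). -/
private theorem klsh_p28 {x : ℝ} (h1 : (157 / 800 : ℝ) ≤ x) (h2 : x ≤ 1 / 5) : |deriv (deriv Real.smoothTransition) x| ≤ 11 :=
  klsh_piece' (a := 157 / 800) (b := 1 / 5) (L := 2107 / 50) (U := 1208 / 25) 30 31 h1 h2 (by norm_num) (by norm_num) (by norm_num) (by norm_num) (by norm_num)
    (by norm_num) (by norm_num) (by norm_num) (by norm_num) (by norm_num)

/-- Piece 29: `x ∈ [77/400, 157/800]` (`m = 30`, `L = 4641/100`; `m' = 32`, `U = 1369/25`). -/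
private theorem klsh_p29 {x : ℝ} (h1 : (77 / 400 : ℝ) ≤ x) (h2 : x ≤ 157 / 800) : |deriv (deriv Real.smoothTransition) x| ≤ 11 :=
  klsh_piece' (a := 77 / 400) (b := 157 / 800) (L := 4641 / 100) (U := 1369 / 25) 30 32 h1 h2 (by norm_num) (by norm_num) (by norm_num) (by norm_num) (by norm_num)
    (by norm_num) (by norm_num) (by norm_num) (by norm_num) (by norm_num)

/-- Piece 30: `x ∈ [151/800, 77/400]` (`m = 31`, `L = 2581/50`; `m' = 33`, `U = 3103/50`). -/
private theorem klsh_p30 {x : ℝ} (h1 : (151 / 800 : ℝ) ≤ x) (h2 : x ≤ 77 / 400) : |deriv (deriv Real.smoothTransition) x| ≤ 11 :=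
  klsh_piece' (a := 151 / 800) (b := 77 / 400) (L := 2581 / 50) (U := 3103 / 50) 31 33 h1 h2 (by norm_num) (by norm_num) (by norm_num) (by norm_num) (by norm_num)
    (by norm_num) (by norm_num) (by norm_num) (by norm_num) (by norm_num)

/-- Piece 31: `x ∈ [147/800, 151/800]` (`m = 32`, `L = 5761/100`; `m' = 34`, `U = 1758/25`). -/
private theorem klsh_p31 {x : ℝ} (h1 : (147 / 800 : ℝ) ≤ x) (h2 : x ≤ 151 / 800) : |deriv (deriv Real.smoothTransition) x| ≤ 11 :=
  klsh_piece' (a := 147 / 800) (b := 151 / 800) (L := 5761 / 100) (U := 1758 / 25) 32 34 h1 h2 (by norm_num) (by norm_num) (by norm_num) (by norm_num) (by norm_num)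
    (by norm_num) (by norm_num) (by norm_num) (by norm_num) (by norm_num)

/-- Piece 32: `x ∈ [143/800, 147/800]` (`m = 33`, `L = 669/10`; `m' = 36`, `U = 9031/100`). -/
private theorem klsh_p32 {x : ℝ} (h1 : (143 / 800 : ℝ) ≤ x) (h2 : x ≤ 147 / 800) : |deriv (deriv Real.smoothTransition) x| ≤ 11 :=
  klsh_piece' (a := 143 / 800) (b := 147 / 800) (L := 669 / 10) (U := 9031 / 100) 33 36 h1 h2 (by norm_num) (by norm_num) (by norm_num) (by norm_num) (by norm_num)
    (by norm_num) (by norm_num) (by norm_num) (by norm_num) (by norm_num)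

/-- Piece 33: `x ∈ [69/400, 143/800]` (`m = 35`, `L = 315/4`; `m' = 37`, `U = 512/5`). -/
private theorem klsh_p33 {x : ℝ} (h1 : (69 / 400 : ℝ) ≤ x) (h2 : x ≤ 143 / 800) : |deriv (deriv Real.smoothTransition) x| ≤ 11 :=
  klsh_piece' (a := 69 / 400) (b := 143 / 800) (L := 315 / 4) (U := 512 / 5) 35 37 h1 h2 (by norm_num) (by norm_num) (by norm_num) (by norm_num) (by norm_num)
    (by norm_num) (by norm_num) (by norm_num) (by norm_num) (by norm_num)

/-- Piece 34: `x ∈ [33/200, 69/400]` (`m = 36`, `L = 1939/20`; `m' = 39`, `U = 263/2`). -/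
private theorem klsh_p34 {x : ℝ} (h1 : (33 / 200 : ℝ) ≤ x) (h2 : x ≤ 69 / 400) : |deriv (deriv Real.smoothTransition) x| ≤ 11 :=
  klsh_piece' (a := 33 / 200) (b := 69 / 400) (L := 1939 / 20) (U := 263 / 2) 36 39 h1 h2 (by norm_num) (by norm_num) (by norm_num) (by norm_num) (by norm_num)
    (by norm_num) (by norm_num) (by norm_num) (by norm_num) (by norm_num)

/-- Piece 35: `x ∈ [31/200, 33/200]` (`m = 38`, `L = 636/5`; `m' = 43`, `U = 1084/5`). -/
private theorem klsh_p35 {x : ℝ} (h1 : (31 / 200 : ℝ) ≤ x) (h2 : x ≤ 33 / 200) : |deriv (deriv Real.smoothTransition) x| ≤ 11 :=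
  klsh_piece' (a := 31 / 200) (b := 33 / 200) (L := 636 / 5) (U := 1084 / 5) 38 43 h1 h2 (by norm_num) (by norm_num) (by norm_num) (by norm_num) (by norm_num)
    (by norm_num) (by norm_num) (by norm_num) (by norm_num) (by norm_num)

/-- Piece 36: `x ∈ [113/800, 31/200]` (`m = 42`, `L = 958/5`; `m' = 48`, `U = 2026/5`). -/
private theorem klsh_p36 {x : ℝ} (h1 : (113 / 800 : ℝ) ≤ x) (h2 : x ≤ 31 / 200) : |deriv (deriv Real.smoothTransition) x| ≤ 11 :=
  klsh_piece' (a := 113 / 800) (b := 31 / 200) (L := 958 / 5) (U := 2026 / 5) 42 48 h1 h2 (by norm_num) (by norm_num) (by norm_num) (by norm_num) (by norm_num)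
    (by norm_num) (by norm_num) (by norm_num) (by norm_num) (by norm_num)

/-- Piece 37: `x ∈ [1/8, 113/800]` (`m = 47`, `L = 3651/10`; `m' = 55`, `U = 4863/5`). -/
private theorem klsh_p37 {x : ℝ} (h1 : (1 / 8 : ℝ) ≤ x) (h2 : x ≤ 113 / 800) : |deriv (deriv Real.smoothTransition) x| ≤ 11 :=
  klsh_piece' (a := 1 / 8) (b := 113 / 800) (L := 3651 / 10) (U := 4863 / 5) 47 55 h1 h2 (by norm_num) (by norm_num) (by norm_num) (by norm_num) (by norm_num)
    (by norm_num) (by norm_num) (by norm_num) (by norm_num) (by norm_num)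
/-- **`|smoothTransition″| ≤ 11` on `[1/8, 1/2]`** (the 37 pieces, chained). -/
theorem klsh_abs_deriv2_le_of_mem_mid {x : ℝ} (h1 : (1 / 8 : ℝ) ≤ x) (h2 : x ≤ 1 / 2) : |deriv (deriv Real.smoothTransition) x| ≤ 11 :=
  (le_or_gt x (113 / 800)).elim (fun c => klsh_p37 h1 c) fun c0 =>
  (le_or_gt x (31 / 200)).elim (fun c => klsh_p36 c0.le c) fun c1 =>
  (le_or_gt x (33 / 200)).elim (fun c => klsh_p35 c1.le c) fun c2 =>
  (le_or_gt x (69 / 400)).elim (fun c => klsh_p34 c2.le c) fun c3 =>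
  (le_or_gt x (143 / 800)).elim (fun c => klsh_p33 c3.le c) fun c4 =>
  (le_or_gt x (147 / 800)).elim (fun c => klsh_p32 c4.le c) fun c5 =>
  (le_or_gt x (151 / 800)).elim (fun c => klsh_p31 c5.le c) fun c6 =>
  (le_or_gt x (77 / 400)).elim (fun c => klsh_p30 c6.le c) fun c7 =>
  (le_or_gt x (157 / 800)).elim (fun c => klsh_p29 c7.le c) fun c8 =>
  (le_or_gt x (1 / 5)).elim (fun c => klsh_p28 c8.le c) fun c9 =>
  (le_or_gt x (81 / 400)).elim (fun c => klsh_p27 c9.le c) fun c10 =>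
  (le_or_gt x (41 / 200)).elim (fun c => klsh_p26 c10.le c) fun c11 =>
  (le_or_gt x (83 / 400)).elim (fun c => klsh_p25 c11.le c) fun c12 =>
  (le_or_gt x (21 / 100)).elim (fun c => klsh_p24 c12.le c) fun c13 =>
  (le_or_gt x (17 / 80)).elim (fun c => klsh_p23 c13.le c) fun c14 =>
  (le_or_gt x (43 / 200)).elim (fun c => klsh_p22 c14.le c) fun c15 =>
  (le_or_gt x (87 / 400)).elim (fun c => klsh_p21 c15.le c) fun c16 =>
  (le_or_gt x (11 / 50)).elim (fun c => klsh_p20 c16.le c) fun c17 =>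
  (le_or_gt x (89 / 400)).elim (fun c => klsh_p19 c17.le c) fun c18 =>
  (le_or_gt x (9 / 40)).elim (fun c => klsh_p18 c18.le c) fun c19 =>
  (le_or_gt x (91 / 400)).elim (fun c => klsh_p17 c19.le c) fun c20 =>
  (le_or_gt x (23 / 100)).elim (fun c => klsh_p16 c20.le c) fun c21 =>
  (le_or_gt x (93 / 400)).elim (fun c => klsh_p15 c21.le c) fun c22 =>
  (le_or_gt x (47 / 200)).elim (fun c => klsh_p14 c22.le c) fun c23 =>
  (le_or_gt x (191 / 800)).elim (fun c => klsh_p13 c23.le c) fun c24 =>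
  (le_or_gt x (97 / 400)).elim (fun c => klsh_p12 c24.le c) fun c25 =>
  (le_or_gt x (197 / 800)).elim (fun c => klsh_p11 c25.le c) fun c26 =>
  (le_or_gt x (201 / 800)).elim (fun c => klsh_p10 c26.le c) fun c27 =>
  (le_or_gt x (41 / 160)).elim (fun c => klsh_p9 c27.le c) fun c28 =>
  (le_or_gt x (21 / 80)).elim (fun c => klsh_p8 c28.le c) fun c29 =>
  (le_or_gt x (217 / 800)).elim (fun c => klsh_p7 c29.le c) fun c30 =>
  (le_or_gt x (9 / 32)).elim (fun c => klsh_p6 c30.le c) fun c31 =>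
  (le_or_gt x (59 / 200)).elim (fun c => klsh_p5 c31.le c) fun c32 =>
  (le_or_gt x (63 / 200)).elim (fun c => klsh_p4 c32.le c) fun c33 =>
  (le_or_gt x (69 / 200)).elim (fun c => klsh_p3 c33.le c) fun c34 =>
  (le_or_gt x (159 / 400)).elim (fun c => klsh_p2 c34.le c) fun c35 =>
  klsh_p1 c35.le h2

/-! ## §2 The bound on `(0, 1)` -/

/-- **`|smoothTransition″| ≤ 11` on `(0, 1)`.** -/
theorem klsh_abs_deriv2_le_of_mem_Ioo {x : ℝ} (h0 : 0 < x) (h1 : x < 1) : |deriv (deriv Real.smoothTransition) x| ≤ 11 := by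
  rcases le_or_gt x (1 / 2) with hle | hgt
  · rcases le_or_gt x (1 / 8) with h8 | h8
    · exact (klsh_abs_deriv2_le_of_le_eighth h0 h8).trans (by norm_num)
    · exact klsh_abs_deriv2_le_of_mem_mid h8.le hle
  · -- reflect
    have hx' : x = 1 - (1 - x) := by ring
    rw [hx', klsh_deriv2_one_sub (by linarith) (by linarith), abs_neg]
    rcases le_or_gt (1 - x) (1 / 8) with h8 | h8
    · exact (klsh_abs_deriv2_le_of_le_eighth (by linarith) h8).trans (by norm_num)
    · exact klsh_abs_deriv2_le_of_mem_mid h8.le (by linarith)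

/-! ## §3 The global bounds -/

/-- **`|smoothTransition″ x| ≤ 11` for every real `x`** (off `[0,1]` it vanishes; end points by continuity and density). -/
theorem klsh_abs_deriv2_smoothTransition_le (x : ℝ) : |deriv (deriv Real.smoothTransition) x| ≤ 11 := by
  have hneg : ∀ y : ℝ, y < 0 → deriv (deriv Real.smoothTransition) y = 0 := by
    intro y hy
    have hev : deriv Real.smoothTransition =ᶠ[𝓝 y] fun _ => (0 : ℝ) := by
      filter_upwards [Iio_mem_nhds hy] with z hz
      exact klcd_deriv_smoothTransition_eq_zero_of_neg hz
    rw [hev.deriv_eq]; simp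
  have hone : ∀ y : ℝ, 1 < y → deriv (deriv Real.smoothTransition) y = 0 := by
    intro y hy
    have hev : deriv Real.smoothTransition =ᶠ[𝓝 y] fun _ => (0 : ℝ) := by
      filter_upwards [Ioi_mem_nhds hy] with z hz
      have hev' : Real.smoothTransition =ᶠ[𝓝 z] fun _ => (1 : ℝ) := by
        filter_upwards [Ioi_mem_nhds hz] with t ht
        exact Real.smoothTransition.one_of_one_le ht.le
      rw [hev'.deriv_eq]; simp
    rw [hev.deriv_eq]; simp
  have hD : ∀ y ∈ ({0}ᶜ ∩ {1}ᶜ : Set ℝ), |deriv (deriv Real.smoothTransition) y| ≤ 11 := by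
    intro y hy
    have hy0 : y ≠ 0 := hy.1
    have hy1 : y ≠ 1 := hy.2
    rcases lt_or_gt_of_ne hy0 with h | h
    · rw [hneg y h, abs_zero]; norm_num
    · rcases lt_or_gt_of_ne hy1 with h' | h'
      · exact klsh_abs_deriv2_le_of_mem_Ioo h h'
      · rw [hone y h', abs_zero]; norm_num
  have hdense : Dense ({0}ᶜ ∩ {1}ᶜ : Set ℝ) :=
    (dense_compl_singleton 0).inter_of_isOpen_left (dense_compl_singleton 1) isOpen_compl_singleton
  have hcont : Continuous fun y => |deriv (deriv Real.smoothTransition) y| := by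
    have h2 : Continuous (iteratedDeriv 2 Real.smoothTransition) :=
      (Real.smoothTransition.contDiff (n := 2)).continuous_iteratedDeriv 2 le_rfl
    have heq : iteratedDeriv 2 Real.smoothTransition = deriv (deriv Real.smoothTransition) := by
      rw [iteratedDeriv_succ, iteratedDeriv_one]
    rw [heq] at h2
    exact h2.abs
  have hclosed : IsClosed {y : ℝ | |deriv (deriv Real.smoothTransition) y| ≤ 11} := isClosed_le hcont continuous_const
  have hsub : closure ({0}ᶜ ∩ {1}ᶜ : Set ℝ) ⊆ {y : ℝ | |deriv (deriv Real.smoothTransition) y| ≤ 11} :=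
    hclosed.closure_subset_iff.mpr hD
  rw [hdense.closure_eq] at hsub
  exact hsub (mem_univ x)

/-- **`|χ₂″ x| ≤ 176/9`** for Salmhofer's cutoff `χ₂(x) = smoothTransition((4x−1)/3)` (`(4/3)²·11`). [cite: Salmhofer1999, §4.2.5 (4.71)] -/
theorem klsh_abs_deriv2_salmhoferCutoff_le (x : ℝ) : |deriv (deriv salmhoferCutoff) x| ≤ 176 / 9 := by
  rw [kltd_deriv2_salmhoferCutoff_eq]
  show |deriv (deriv Real.smoothTransition) ((4 * x - 1) / 3) * (4 / 3) * (4 / 3)| ≤ 176 / 9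
  rw [abs_mul, abs_mul, abs_of_pos (by norm_num : (0:ℝ) < 4 / 3)]
  have := klsh_abs_deriv2_smoothTransition_le ((4 * x - 1) / 3)
  nlinarith

/-- Numeric form: `|χ₂″ x| < 19.6`. -/
theorem klsh_abs_deriv2_salmhoferCutoff_lt (x : ℝ) : |deriv (deriv salmhoferCutoff) x| < 19.6 :=
  (klsh_abs_deriv2_salmhoferCutoff_le x).trans_lt (by norm_num)

/-- **`|χ₂′ x| ≤ 8/3`** (sharp: `sup σ′ = 2`, the Balaban-profile file's `abs_deriv_smoothTransition_le_two`, times `4/3`;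
the tree's `klcd_abs_deriv_salmhoferCutoff_le_sharp` has `32/3`). [cite: Salmhofer1999, §4.2.5 (4.71)] -/
theorem klsh_abs_deriv_salmhoferCutoff_le (x : ℝ) : |deriv salmhoferCutoff x| ≤ 8 / 3 := by
  rw [klsd_deriv_salmhoferCutoff_eq]
  show |deriv Real.smoothTransition ((4 * x - 1) / 3) * (4 / 3)| ≤ 8 / 3
  rw [abs_mul, abs_of_pos (by norm_num : (0:ℝ) < 4 / 3)]
  have h := Literature.MathematicalPhysics.QuantumFieldTheory.Balaban1983to89.B12Profile270Bounds.abs_deriv_smoothTransition_le_two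
    ((4 * x - 1) / 3)
  linarith

/-- The operator-norm form for the (C1) size tables: `‖iteratedFDeriv ℝ 2 χ₂ x‖ ≤ 176/9`. -/
theorem norm_iteratedFDeriv_two_salmhoferCutoff_le_sharp (x : ℝ) : ‖iteratedFDeriv ℝ 2 salmhoferCutoff x‖ ≤ 176 / 9 := by
  rw [norm_iteratedFDeriv_eq_norm_iteratedDeriv, iteratedDeriv_succ, iteratedDeriv_one, Real.norm_eq_abs]
  exact klsh_abs_deriv2_salmhoferCutoff_le x

end Summit.HubbardSuperconductivity.HubbardSuperconductivity.Theorems.KLRegimeSplit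

end
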